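import Mathlib
import Literature.NumberTheory.Transcendental.AssociatorsLowDegreeProofs
import HarnessLib

/-!
# Associators: the weight-three content of Drinfeld's pentagon equation

Proofs file in the associator series (`Associators.lean` §7 proved the weight-one consequence
`c_{X₀} = c_{X₁} = 0` of the pentagon; `AssociatorsLowDegreeProofs.lean` treats weight `≤ 2`).
Here: **for every solution `φ ∈ R⟨⟨X₀,X₁⟩⟩` of Drinfeld's pentagon equation
(`NCSeries.DrinfeldPentagon`, [Furusho2011, §2]) over a commutative ring `R` with `c_∅(φ) = 1` and
`c_{X₀}(φ) = c_{X₁}(φ) = 0`, one has `c_{X₀X₀X₁}(φ) + c_{X₀X₁X₁}(φ) = 0`**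
(`NCSeries.DrinfeldPentagon.apply_weight_three`). No group-likeness is assumed. For the KZ
associator this is Euler's `ζ(3) = ζ(2,1)` (`c_{X₀X₀X₁}(Φ_KZ) = -ζ(3)`, `c_{X₀X₁X₁}(Φ_KZ) = ζ(2,1)`);
for the rules associator of route KontsevichZagierPeriods/FurushoPentagon it is the first rung of
the crux `PentagonInKZ` (refuter's disproof file, item stmt-KontsevichZagierPeriods-11348).

## Method

The **shifted permutation representation** of the weight-truncated Drinfeld–Kohno algebra
`U𝔞₄ ⊗ R/(deg > 3)` (`DrinfeldKohnoTrunc R (Fin 4) 3`): `t_ij ↦ (P_{(i j)} - 1) ⊗ J`, where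
`P_{(i j)} ∈ M₄(ℤ)` is the permutation matrix of the transposition and `J ∈ M₄(ℤ)` the nilpotent
Jordan block (`J⁴ = 0`). Transposition matrices satisfy the infinitesimal braid relations
`[P_ij, P_ik + P_jk] = 0` and locality exactly (the classical representation of `𝔞_n` on `V^{⊗ n}`
by transposed Casimirs, here for `𝔤𝔩₁`-like rank; all identities are `decide`d over `ℤ`), the shift
by `-1` is central, and the factor `J` enforces the weight truncation and GRADES the image: the
`J³`-component of `φ(a ⊗ J, b ⊗ J)` is `Σ_{|w|=3} c_w(φ) w(a,b)` (`NCSeries.permRep_factor_eq`).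
Reading the entry `((0,0),(3,3))` of the pentagon identity gives
`-5(c_{xxy} + c_{xyy}) = -6(c_{xxy} + c_{xyy})`.
(The other weight-3 consequences visible in this representation — `c_{xyx} = 2c_{xyy}`,
`c_{yxy} = 2c_{xxy}`, `c_{yxx} = -c_{yyx}`, `c_{xyx} = 2c_{yyx}`, `13 c_{xxx} = 13 c_{yyy} = 0` —
are read off other entries the same way; not included.)

## References

* H. Furusho, *Double shuffle relation for associators*, Ann. of Math. 174 (2011), §2.
  [Furusho2011]
* V. G. Drinfel'd, *On quasitriangular quasi-Hopf algebras and on a group that is closely connected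
  with Gal(Q̄/Q)*, Leningrad Math. J. 2 (1991) (the pentagon; `Φ_KZ` in low degree). [Drinfeld1991]
* D. Bar-Natan, *On associators and the Grothendieck–Teichmuller group I*, Selecta Math. 4 (1998)
  (weight-by-weight linear algebra of the pentagon). [BarNatan1998]
-/

noncomputable section

open Matrix
open scoped BigOperators Kronecker

namespace Literature.NumberTheory.Transcendental

universe u v

namespace NCSeries

/-! ## 1. Evaluation in weight `≤ 3` -/

section EvalThree

variable {α : Type u} {R : Type v} [CommSemiring R] {A : Type*} [Semiring A] [Algebra R A]
  [Fintype α]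

/-- In weight `≤ 3`: `evalTrunc 3 v φ = evalTrunc 2 v φ + Σ_{a,b,c} c_{abc}(φ) · v(a) v(b) v(c)`.
[folklore] -/
theorem evalTrunc_three_eq (v : α → A) (φ : NCSeries α R) :
    evalTrunc 3 v φ = evalTrunc 2 v φ + ∑ a, ∑ b, ∑ c, φ [a, b, c] • (v a * v b * v c) := by
  unfold evalTrunc
  rw [Finset.sum_range_succ]
  congr 1
  rw [← (Fin.consEquiv fun _ : Fin 3 => α).sum_comp, Fintype.sum_prod_type]
  refine Finset.sum_congr rfl fun a _ => ?_
  rw [← (finTwoArrowEquiv α).symm.sum_comp, Fintype.sum_prod_type]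
  refine Finset.sum_congr rfl fun b _ => Finset.sum_congr rfl fun c _ => ?_
  simp [finTwoArrowEquiv, Fin.consEquiv, List.ofFn_succ, mul_assoc]

end EvalThree

/-! ## 2. The shifted permutation representation of `U𝔞₄/(deg > 3)` -/

namespace PermRep

/-- `Qz (i, j) = P_{(i j)} - 1 ∈ M₄(ℤ)`: the permutation matrix of the transposition `(i j)` minus
the identity (`0` for `i = j`). [folklore] -/
def Qz (p : Fin 4 × Fin 4) : Matrix (Fin 4) (Fin 4) ℤ := (Equiv.swap p.1 p.2).permMatrix ℤ - 1

/-- The nilpotent Jordan block `J ∈ M₄(ℤ)`, `J_{a,a+1} = 1`. [folklore] -/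
def Jz : Matrix (Fin 4) (Fin 4) ℤ := Matrix.of fun a b => if a.val + 1 = b.val then 1 else 0

/-- `Qz (i, i) = 0`. [folklore] -/
theorem Qz_diag : ∀ i : Fin 4, Qz (i, i) = 0 := by decide

/-- `Qz (i, j) = Qz (j, i)`. [folklore] -/
theorem Qz_symm : ∀ i j : Fin 4, Qz (i, j) = Qz (j, i) := by decide

/-- **Transposition matrices satisfy the infinitesimal braid relations** `[t_ij, t_ik + t_jk] = 0`
(`(i j)(i k) = (j k)(i j)` and `(i j)(j k) = (i k)(i j)` in `S₄`; the shift by `-1` is central).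
[folklore] -/
theorem Qz_fourTerm : ∀ i j k : Fin 4, i ≠ j → j ≠ k → i ≠ k →
    Qz (i, j) * (Qz (i, k) + Qz (j, k)) = (Qz (i, k) + Qz (j, k)) * Qz (i, j) := by decide

/-- Locality: disjoint transpositions commute. [folklore] -/
theorem Qz_locality : ∀ i j k l : Fin 4, i ≠ j → i ≠ k → i ≠ l → j ≠ k → j ≠ l → k ≠ l →
    Qz (i, j) * Qz (k, l) = Qz (k, l) * Qz (i, j) := by decide

/-- `J⁴ = 0`, `(J²)₀₃ = 0`, `(J³)₀₃ = 1`. [folklore] -/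
theorem Jz_facts : Jz ^ 4 = 0 ∧ (Jz * Jz) 0 3 = 0 ∧ (Jz * Jz * Jz) 0 3 = 1 := by decide

variable {S : Type u} [CommRing S]

variable (S) in
/-- Change of scalars `M₄(ℤ) → M₄(S)`. [folklore] -/
abbrev Fm : Matrix (Fin 4) (Fin 4) ℤ →+* Matrix (Fin 4) (Fin 4) S := (Int.castRingHom S).mapMatrix

variable (S) in
/-- The Jordan block over `S`. [folklore] -/
abbrev Jm : Matrix (Fin 4) (Fin 4) S := Fm S Jz

/-- `J⁴ = 0` over `S`. [folklore] -/
theorem J_pow_four : (Jm S) ^ 4 = 0 := by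
  rw [Jm, ← map_pow, Jz_facts.1, map_zero]

variable (S) in
/-- The representation on generators: `t_ij ↦ (P_{(i j)} - 1) ⊗ J ∈ M₄(S) ⊗ M₄(S)`. [folklore] -/
def v (p : Fin 4 × Fin 4) : Matrix (Fin 4 × Fin 4) (Fin 4 × Fin 4) S := Fm S (Qz p) ⊗ₖ Jm S

/-- **The shifted permutation representation** `U𝔞₄ ⊗ S/(deg > 3) → M₁₆(S)`, `t_ij ↦ (P_{(ij)} - 1) ⊗ J`:
all defining relations of `DrinfeldKohnoTrunc S (Fin 4) 3` hold (braid relations and locality from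
`Qz_fourTerm`, `Qz_locality`; products of four generators vanish since `J⁴ = 0`). [folklore] -/
theorem exists_algHom : ∃ W : DrinfeldKohnoTrunc S (Fin 4) 3 →ₐ[S] Matrix (Fin 4 × Fin 4) (Fin 4 × Fin 4) S,
    ∀ i j, W (DrinfeldKohnoTrunc.t S 3 i j) = v S (i, j) := by
  classical
  refine ⟨RingQuot.liftAlgHom S ⟨FreeAlgebra.lift S (v S), fun a b hab => ?_⟩, fun i j => ?_⟩
  · cases hab with
    | diag i => simp [v, Qz_diag]
    | symm i j => simp [v, Qz_symm i j]
    | fourTerm i j k hij hjk hik =>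
      simp only [map_mul, map_add, FreeAlgebra.lift_ι_apply, v]
      simp only [← Matrix.add_kronecker, ← Matrix.mul_kronecker_mul, ← map_add (Fm S),
        ← map_mul (Fm S), Qz_fourTerm i j k hij hjk hik]
    | locality i j k l hij hik hil hjk hjl hkl =>
      simp only [map_mul, FreeAlgebra.lift_ι_apply, v]
      simp only [← Matrix.mul_kronecker_mul, ← map_mul (Fm S), Qz_locality i j k l hij hik hil hjk hjl hkl]
    | trunc g =>
      rw [map_list_prod, map_zero, List.map_ofFn]
      simp only [Function.comp_def, FreeAlgebra.lift_ι_apply, v, List.ofFn_succ, List.ofFn_zero,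
        List.prod_cons, List.prod_nil, mul_one, ← Matrix.mul_kronecker_mul]
      have h4 : Jm S * (Jm S * (Jm S * Jm S)) = 0 := by
        have := J_pow_four (S := S)
        simpa [pow_succ, mul_assoc] using this
      rw [h4, Matrix.kronecker_zero]
  · exact (RingQuot.liftAlgHom_mkAlgHom_apply S (FreeAlgebra.lift S (v S)) _ _).trans
      (FreeAlgebra.lift_ι_apply _ _)

/-- **`J`-graded form of a pentagon factor**: for `φ` with `c_∅ = 1`, `c_{X₀} = c_{X₁} = 0` and
`A, B ∈ M₄(S)`, `φ(A ⊗ J, B ⊗ J) = 1 + X₂ ⊗ J² + X₃ ⊗ J³` in weight `≤ 3`, with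
`X₂ = Σ c_{ab} · ab`, `X₃ = Σ c_{abc} · abc` (letters substituted `X₀ ↦ A`, `X₁ ↦ B`). [folklore] -/
theorem factor_eq {φ : NCSeries Bool S} (h0 : φ [] = 1) (hx : φ [false] = 0) (hy : φ [true] = 0)
    (A B : Matrix (Fin 4) (Fin 4) S) :
    evalTrunc 3 (bsub (A ⊗ₖ Jm S) (B ⊗ₖ Jm S)) φ =
      1 + (∑ a, ∑ b, φ [a, b] • (bsub A B a * bsub A B b)) ⊗ₖ (Jm S * Jm S) +
        (∑ a, ∑ b, ∑ c, φ [a, b, c] • (bsub A B a * bsub A B b * bsub A B c)) ⊗ₖ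
          (Jm S * Jm S * Jm S) := by
  rw [evalTrunc_three_eq, evalTrunc_two_eq, h0, one_smul]
  simp only [Fintype.sum_bool, hx, hy, zero_smul, add_zero, bsub_false, bsub_true,
    ← Matrix.mul_kronecker_mul, Matrix.add_kronecker, Matrix.smul_kronecker]

end PermRep

/-! ## 3. The weight-three content of the pentagon -/

variable {S : Type u} [CommRing S]

open PermRep in
/-- **Weight three of Drinfeld's pentagon.** For every solution `φ` of the pentagon equation
(`NCSeries.DrinfeldPentagon`, [Furusho2011, §2 (pentagon)]) over a commutative ring with
`c_∅(φ) = 1` and `c_{X₀}(φ) = c_{X₁}(φ) = 0`: `c_{X₀X₀X₁}(φ) + c_{X₀X₁X₁}(φ) = 0`. (For group-like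
`φ` the weight-3 part is then a multiple of Drinfeld's element; for `Φ_KZ` this is
`ζ(3) = ζ(2,1)`.) Proof: apply the shifted permutation representation to the weight-`3`
truncation of the pentagon, expand each factor by `factor_eq`, kill `J^{≥4}`, and read the entry
`((0,0),(3,3))`; the forty integer matrix entries are decided. [folklore] -/
theorem DrinfeldPentagon.apply_weight_three {φ : NCSeries Bool S} (h : DrinfeldPentagon φ)
    (h0 : φ [] = 1) (hx : φ [false] = 0) (hy : φ [true] = 0) :
    φ [false, false, true] + φ [false, true, true] = 0 := by
  obtain ⟨W, hW⟩ := exists_algHom (S := S)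
  have hsub : ∀ a b : DrinfeldKohnoTrunc S (Fin 4) 3,
      W (subst₂ 3 φ a b) = evalTrunc 3 (bsub (W a) (W b)) φ := by
    intro a b
    rw [subst₂, algHom_evalTrunc]
    congr 1
    funext c; cases c <;> rfl
  have hJ5 : ∀ {n : ℕ}, 4 ≤ n → (Jm S) ^ n = 0 := fun hn => by
    obtain ⟨k, rfl⟩ := Nat.exists_eq_add_of_le hn
    rw [pow_add, J_pow_four, zero_mul]
  have J_mul4a : Jm S * Jm S * (Jm S * Jm S) = 0 := by
    rw [show Jm S * Jm S * (Jm S * Jm S) = Jm S ^ 4 by noncomm_ring]; exact J_pow_four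
  have J_mul4b : Jm S * Jm S * (Jm S * Jm S * Jm S) = 0 := by
    rw [show Jm S * Jm S * (Jm S * Jm S * Jm S) = Jm S ^ 5 by noncomm_ring]; exact hJ5 (by norm_num)
  have J_mul4c : Jm S * Jm S * Jm S * (Jm S * Jm S) = 0 := by
    rw [show Jm S * Jm S * Jm S * (Jm S * Jm S) = Jm S ^ 5 by noncomm_ring]; exact hJ5 (by norm_num)
  have J_mul4d : Jm S * Jm S * Jm S * (Jm S * Jm S * Jm S) = 0 := by
    rw [show Jm S * Jm S * Jm S * (Jm S * Jm S * Jm S) = Jm S ^ 6 by noncomm_ring]; exact hJ5 (by norm_num)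
  have hp := congrArg W (h 3)
  simp only [map_mul, hsub, map_add, t₄, hW, v] at hp
  simp only [← Matrix.add_kronecker, ← map_add (Fm S)] at hp
  simp only [factor_eq h0 hx hy] at hp
  simp only [mul_add, add_mul, one_mul, mul_one, ← Matrix.mul_kronecker_mul, J_mul4a, J_mul4b,
    J_mul4c, J_mul4d, Matrix.kronecker_zero, add_zero] at hp
  have hne : ((0 : Fin 4), (0 : Fin 4)) ≠ ((3 : Fin 4), (3 : Fin 4)) := by decide
  have he := congrArg (fun M : Matrix (Fin 4 × Fin 4) (Fin 4 × Fin 4) S =>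
    M ((0 : Fin 4), (0 : Fin 4)) ((3 : Fin 4), (3 : Fin 4))) hp
  simp only [Matrix.add_apply, Matrix.kroneckerMap_apply, Matrix.one_apply_ne hne, zero_add,
    Fintype.sum_bool, bsub_false, bsub_true, Matrix.smul_apply, smul_eq_mul,
    ← map_mul (Fm S)] at he
  -- the decided integer entries `(word(A_k, B_k))₀₃` of the five substitutions
  have ent1_fff : (Qz (0, 1) * Qz (0, 1) * Qz (0, 1)) 0 3 = 0 := by decide
  have ent1_fft : (Qz (0, 1) * Qz (0, 1) * (Qz (1, 2) + Qz (1, 3))) 0 3 = -2 := by decide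
  have ent1_ftf : (Qz (0, 1) * (Qz (1, 2) + Qz (1, 3)) * Qz (0, 1)) 0 3 = 0 := by decide
  have ent1_ftt : (Qz (0, 1) * (Qz (1, 2) + Qz (1, 3)) * (Qz (1, 2) + Qz (1, 3))) 0 3 = -3 := by decide
  have ent1_tff : ((Qz (1, 2) + Qz (1, 3)) * Qz (0, 1) * Qz (0, 1)) 0 3 = 0 := by decide
  have ent1_tft : ((Qz (1, 2) + Qz (1, 3)) * Qz (0, 1) * (Qz (1, 2) + Qz (1, 3))) 0 3 = 0 := by decide
  have ent1_ttf : ((Qz (1, 2) + Qz (1, 3)) * (Qz (1, 2) + Qz (1, 3)) * Qz (0, 1)) 0 3 = 0 := by decide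
  have ent1_ttt : ((Qz (1, 2) + Qz (1, 3)) * (Qz (1, 2) + Qz (1, 3)) * (Qz (1, 2) + Qz (1, 3))) 0 3 = 0 := by decide
  have ent2_fff : ((Qz (0, 2) + Qz (1, 2)) * (Qz (0, 2) + Qz (1, 2)) * (Qz (0, 2) + Qz (1, 2))) 0 3 = 0 := by decide
  have ent2_fft : ((Qz (0, 2) + Qz (1, 2)) * (Qz (0, 2) + Qz (1, 2)) * Qz (2, 3)) 0 3 = -3 := by decide
  have ent2_ftf : ((Qz (0, 2) + Qz (1, 2)) * Qz (2, 3) * (Qz (0, 2) + Qz (1, 2))) 0 3 = 0 := by decide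
  have ent2_ftt : ((Qz (0, 2) + Qz (1, 2)) * Qz (2, 3) * Qz (2, 3)) 0 3 = -2 := by decide
  have ent2_tff : (Qz (2, 3) * (Qz (0, 2) + Qz (1, 2)) * (Qz (0, 2) + Qz (1, 2))) 0 3 = 0 := by decide
  have ent2_tft : (Qz (2, 3) * (Qz (0, 2) + Qz (1, 2)) * Qz (2, 3)) 0 3 = 0 := by decide
  have ent2_ttf : (Qz (2, 3) * Qz (2, 3) * (Qz (0, 2) + Qz (1, 2))) 0 3 = 0 := by decide
  have ent2_ttt : (Qz (2, 3) * Qz (2, 3) * Qz (2, 3)) 0 3 = 0 := by decide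
  have ent3_fff : (Qz (1, 2) * Qz (1, 2) * Qz (1, 2)) 0 3 = 0 := by decide
  have ent3_fft : (Qz (1, 2) * Qz (1, 2) * Qz (2, 3)) 0 3 = 0 := by decide
  have ent3_ftf : (Qz (1, 2) * Qz (2, 3) * Qz (1, 2)) 0 3 = 0 := by decide
  have ent3_ftt : (Qz (1, 2) * Qz (2, 3) * Qz (2, 3)) 0 3 = 0 := by decide
  have ent3_tff : (Qz (2, 3) * Qz (1, 2) * Qz (1, 2)) 0 3 = 0 := by decide
  have ent3_tft : (Qz (2, 3) * Qz (1, 2) * Qz (2, 3)) 0 3 = 0 := by decide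
  have ent3_ttf : (Qz (2, 3) * Qz (2, 3) * Qz (1, 2)) 0 3 = 0 := by decide
  have ent4_fff : ((Qz (0, 1) + Qz (0, 2)) * (Qz (0, 1) + Qz (0, 2)) * (Qz (0, 1) + Qz (0, 2))) 0 3 = 0 := by decide
  have ent4_fft : ((Qz (0, 1) + Qz (0, 2)) * (Qz (0, 1) + Qz (0, 2)) * (Qz (1, 3) + Qz (2, 3))) 0 3 = -6 := by decide
  have ent4_ftf : ((Qz (0, 1) + Qz (0, 2)) * (Qz (1, 3) + Qz (2, 3)) * (Qz (0, 1) + Qz (0, 2))) 0 3 = 0 := by decide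
  have ent4_ftt : ((Qz (0, 1) + Qz (0, 2)) * (Qz (1, 3) + Qz (2, 3)) * (Qz (1, 3) + Qz (2, 3))) 0 3 = -6 := by decide
  have ent4_tff : ((Qz (1, 3) + Qz (2, 3)) * (Qz (0, 1) + Qz (0, 2)) * (Qz (0, 1) + Qz (0, 2))) 0 3 = 0 := by decide
  have ent4_tft : ((Qz (1, 3) + Qz (2, 3)) * (Qz (0, 1) + Qz (0, 2)) * (Qz (1, 3) + Qz (2, 3))) 0 3 = 0 := by decide
  have ent4_ttf : ((Qz (1, 3) + Qz (2, 3)) * (Qz (1, 3) + Qz (2, 3)) * (Qz (0, 1) + Qz (0, 2))) 0 3 = 0 := by decide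
  have ent4_ttt : ((Qz (1, 3) + Qz (2, 3)) * (Qz (1, 3) + Qz (2, 3)) * (Qz (1, 3) + Qz (2, 3))) 0 3 = 0 := by decide
  have ent5_fft : (Qz (0, 1) * Qz (0, 1) * Qz (1, 2)) 0 3 = 0 := by decide
  have ent5_ftf : (Qz (0, 1) * Qz (1, 2) * Qz (0, 1)) 0 3 = 0 := by decide
  have ent5_ftt : (Qz (0, 1) * Qz (1, 2) * Qz (1, 2)) 0 3 = 0 := by decide
  have ent5_tff : (Qz (1, 2) * Qz (0, 1) * Qz (0, 1)) 0 3 = 0 := by decide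
  have ent5_tft : (Qz (1, 2) * Qz (0, 1) * Qz (1, 2)) 0 3 = 0 := by decide
  have ent5_ttf : (Qz (1, 2) * Qz (1, 2) * Qz (0, 1)) 0 3 = 0 := by decide
  simp only [RingHom.mapMatrix_apply, Matrix.map_apply, Jz_facts.2.1, Jz_facts.2.2,
    ent1_fff, ent1_fft, ent1_ftf, ent1_ftt, ent1_tff, ent1_tft, ent1_ttf, ent1_ttt, ent2_fff, ent2_fft, ent2_ftf, ent2_ftt, ent2_tff, ent2_tft, ent2_ttf, ent2_ttt, ent3_fff, ent3_fft, ent3_ftf, ent3_ftt, ent3_tff, ent3_tft, ent3_ttf, ent4_fff, ent4_fft, ent4_ftf, ent4_ftt, ent4_tff, ent4_tft, ent4_ttf, ent4_ttt, ent5_fft, ent5_ftf, ent5_ftt, ent5_tff, ent5_tft, ent5_ttf,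
    map_zero, map_one, map_neg, map_ofNat, mul_zero, add_zero, zero_add] at he
  linear_combination he

end NCSeries

end Literature.NumberTheory.Transcendental

end
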